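import Summits.BirchSwinnertonDyer.Rank1Residual.P2.CongruentNumberThetaFourPrimesBSD
import Summits.BirchSwinnertonDyer.Rank1Residual.P2.CongruentNumberPairsAtTwoEvenDoorDescent
import HarnessLib

/-!
# Cell `bsd-monsky` (prover-B): `BSD(E_n, 2)` AT `k = 4` WITHOUT a `2`-Selmer display — `ord_{s=1} L = 1`, rank `1`,
# `Ш[2^∞] = 0` and the `2`-part of BSD for `n = 2p₁p₂p₃p₄` of the type `(3,5,5,5)` with `g(n)` odd, relative to
# {`tyz_cmPointGaloisData`, TYZ Thm. 1.1, GZK} ONLY (kernel theorems; nothing asserted)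

HONEST FRAMING (cell `bsd-monsky`, run/shared/lean/pub/bsd-monsky/; README §1/§3): the cell's CLAIMED theorem is Monsky's 1990
conjecture (a)+(b) on `𝒮⁻` (`k = 2`); the `k = 4` statement is a RECORD (paper Remark 5.2 / §6 (F7)), not a claim. The landed
record `P2/CongruentNumberThetaFourPrimesBSD.lean` took Aoki 1999 Thm. 2.2 (`hAo`) as the `2`-Selmer input of the uniform even
door (`#Sel₂(E_n) = 8 ⟹ Ш[2^∞] = 0` given rank `1`). The tree now PROVES `#Sel₂(E_{2p₁⋯p_k}) ≤ 2^{2+s}` for every `k`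
(`Literature/…/CongruentNumberEvenMonskySelmerBound.lean`, complete `2`-descent on Selmer classes) and the uniform even door modulo
GZK only (`P2/CongruentNumberPairsAtTwoEvenDoorDescent.lean`). THIS FILE: the `(p, q, r, s)` door modulo GZK only (§1,
`…_pqrs_descent`, exponent `6 = 2·4 − 2`) and the `(3,5,5,5)` family theorem relative to {`tyz_cmPointGaloisData`,
`thm11_parity_of_scriptL`, GZK} ONLY (§2, `rankOne_sha_bsdp_two_two_mul_3555_family_descent`; `s(n) = 1` is kernel-decided on the
type, `monskySelmerRankEven_3555`; the rank-one datum is the record's `rankOneDatum_two_mul_3555`). CONDITIONAL on the three named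
facts; nothing asserted; no count moves; no class booked; NOT refereed; not part of PROOF-B v1.3 or of the paper's claim.

References: [TianYuanZhang2017] §1 (1.1), Thm. 1.1, Thm. 3.5, §3; [HeathBrown1994SelmerCongruentII] Appendix (Monsky), typescript
p. 41 L1–L36 (even case; upper bound a tree theorem); [SilvermanAEC2009] Prop. X.1.4, X.4.9, Thm. X.4.2; [Miller2011LMS] Def. 1.1.
-/

noncomputable section

open scoped Classical

open Matrix Finset WeierstrassCurve Literature.NumberTheory.EllipticCurves
  Literature.NumberTheory.EllipticCurves.Rank1Residual
  Literature.NumberTheory.EllipticCurves.Rank1Residual.Typed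
  Literature.NumberTheory.EllipticCurves.HeathBrown1994
  Literature.NumberTheory.EllipticCurves.HeathBrown1994.Families
  Literature.NumberTheory.EllipticCurves.Tian2014
  Literature.NumberTheory.EllipticCurves.TianYuanZhang2017
  Literature.NumberTheory.EllipticCurves.TianYuanZhang2017.W2
  Literature.NumberTheory.QuadraticFields.RedeiReichardt

set_option autoImplicit false

namespace Summit.BirchSwinnertonDyer.Rank1Residual.P2

namespace ThetaDescent

variable {p₁ p₂ p₃ p₄ : ℕ}

/-! ## §1 The `(p, q, r, s)` door modulo GZK only -/

/-- **THE EVEN `ℓ = 4` DOOR, `(p, q, r, s)` form, binder `hGZK` ONLY.** For pairwise distinct primes `p, q, r, s` with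
`2pqrs ≡ 6 (mod 8)`, `monskySelmerRankEven ![p, q, r, s] = 1`, and ANY rank-one datum `L′(E_{2pqrs}, 1) = x·Ω·Reg`, `x ≠ 0`:
`ord_{s=1} L = 1`, rank `1`, `Ш[2^∞] = 0`, and `BSD(E_{2pqrs}, 2) ⟺ ord₂ x = 6` — the `2`-Selmer input is the tree's complete
`2`-descent. CONDITIONAL on `hGZK`; nothing asserted. [cite: HeathBrown1994SelmerCongruentII, Appendix (Monsky), typescript p. 41 L20–L36]
[cite: SilvermanAEC2009, Prop. X.1.4, Prop. X.4.9, Thm. X.4.2] [cite: Miller2011LMS, Def. 1.1 (arXiv:1010.2431 p. 3)] -/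
theorem rankOne_sha_bsdp_two_iff_congruentNumberCurve_two_mul_pqrs_descent
    (hGZK : rank_eq_analyticRank_of_analyticRank_le_one)
    {p q r s : ℕ} (hp : p.Prime) (hq : q.Prime) (hr : r.Prime) (hs : s.Prime) (hpq : p ≠ q) (hpr : p ≠ r)
    (hps : p ≠ s) (hqr : q ≠ r) (hqs : q ≠ s) (hrs : r ≠ s) (h8 : 2 * (p * q * r * s) % 8 = 6)
    (hsel : monskySelmerRankEven ![p, q, r, s] = 1) {x : ℚ} (hx0 : x ≠ 0)
    (hx : deriv (congruentNumberCurve (2 * (p * q * r * s))).entireLFunction 1 =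
      (x : ℂ) * ((congruentNumberCurve (2 * (p * q * r * s))).realPeriodRat : ℂ) *
        ((congruentNumberCurve (2 * (p * q * r * s))).regulator : ℂ)) :
    (congruentNumberCurve (2 * (p * q * r * s))).analyticRank = 1 ∧
      (congruentNumberCurve (2 * (p * q * r * s))).mordellWeilRank = 1 ∧
      AddCommGroup.primaryComponent (congruentNumberCurve (2 * (p * q * r * s))).sha 2 = ⊥ ∧
      (BSDp (congruentNumberCurve (2 * (p * q * r * s))) 2 ↔ padicValRat 2 x = 6) := by
  have ht : ∀ i, (![p, q, r, s] i).Prime := fun i => by fin_cases i <;> assumption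
  have hinj : Function.Injective ![p, q, r, s] := by
    intro i j h
    fin_cases i <;> fin_cases j <;> simp_all
  have hn : 2 * ∏ i, ![p, q, r, s] i = 2 * (p * q * r * s) := by rw [Fin.prod_univ_four]; rfl
  obtain ⟨h1, h2, h3, h4⟩ :=
    rankOne_sha_bsdp_two_iff_congruentNumberCurve_two_mul_prod_descent ![p, q, r, s] hGZK ht hinj hn h8 hsel hx0 hx
  refine ⟨h1, h2, h3, ?_⟩
  rw [h4]
  norm_num

/-! ## §2 `BSD(E_n, 2)` on the `k = 4` family, relative to {display, TYZ Thm. 1.1, GZK} only -/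

/-- **`BSD(E_n, 2)` AT `k = 4` on the explicit family WITHOUT a `2`-Selmer display — `ord_{s=1} L = 1`, rank `1`, `Ш[2^∞] = 0`,
`BSD(E_n, 2)`** for `n = 2p₁p₂p₃p₄`, distinct primes `p₁ ≡ 3`, `p₂ ≡ p₃ ≡ p₄ ≡ 5 (mod 8)` such that the number of pairs of
`−1`-symbols among `(p₂/p₁), (p₃/p₁), (p₄/p₁), (p₃/p₂), (p₄/p₂), (p₄/p₃)` sharing a prime is even (⟺ `g(n)` odd), relative to THREE
named facts: `tyz_cmPointGaloisData`, `thm11_parity_of_scriptL`, GZK — `s(n) = 1` is kernel-decided on the type (`monskySelmerRankEven_3555`)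
and `#Sel₂ ≤ 2^{2+s} = 8` is the tree's complete `2`-descent. CONDITIONAL; nothing asserted; closes no class by itself (census member
`11310 = 2·3·5·13·29`). [cite: TianYuanZhang2017, §1 (1.1), Thm. 1.1, Thm. 3.5, §3]
[cite: HeathBrown1994SelmerCongruentII, Appendix (Monsky), typescript p. 41 L20–L36] [cite: SilvermanAEC2009, Prop. X.1.4, Prop. X.4.9, Thm. X.4.2]
[cite: Miller2011LMS, Def. 1.1 (arXiv:1010.2431 p. 3)] -/
theorem rankOne_sha_bsdp_two_two_mul_3555_family_descent (hCM : tyz_cmPointGaloisData) (h11 : thm11_parity_of_scriptL)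
    (hGZK : rank_eq_analyticRank_of_analyticRank_le_one) :
    ∀ p₁ p₂ p₃ p₄ : ℕ, p₁.Prime → p₂.Prime → p₃.Prime → p₄.Prime → p₁ % 8 = 3 → p₂ % 8 = 5 → p₃ % 8 = 5 → p₄ % 8 = 5 →
      p₂ ≠ p₃ → p₂ ≠ p₄ → p₃ ≠ p₄ →
      kroneckerBit p₂ p₁ * kroneckerBit p₃ p₁ + kroneckerBit p₂ p₁ * kroneckerBit p₄ p₁ +
        kroneckerBit p₂ p₁ * kroneckerBit p₃ p₂ + kroneckerBit p₂ p₁ * kroneckerBit p₄ p₂ +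
        kroneckerBit p₃ p₁ * kroneckerBit p₄ p₁ + kroneckerBit p₃ p₁ * kroneckerBit p₃ p₂ + kroneckerBit p₃ p₁ * kroneckerBit p₄ p₃ +
        kroneckerBit p₄ p₁ * kroneckerBit p₄ p₂ + kroneckerBit p₄ p₁ * kroneckerBit p₄ p₃ +
        kroneckerBit p₃ p₂ * kroneckerBit p₄ p₂ + kroneckerBit p₃ p₂ * kroneckerBit p₄ p₃ +
        kroneckerBit p₄ p₂ * kroneckerBit p₄ p₃ = 0 →
      (congruentNumberCurve (2 * (p₁ * p₂ * p₃ * p₄))).analyticRank = 1 ∧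
        (congruentNumberCurve (2 * (p₁ * p₂ * p₃ * p₄))).mordellWeilRank = 1 ∧
        AddCommGroup.primaryComponent (congruentNumberCurve (2 * (p₁ * p₂ * p₃ * p₄))).sha 2 = ⊥ ∧
        BSDp (congruentNumberCurve (2 * (p₁ * p₂ * p₃ * p₄))) 2 := by
  intro p₁ p₂ p₃ p₄ hp₁ hp₂ hp₃ hp₄ h₁ h₂ h₃ h₄ h23 h24 h34 hbits
  have h12 : p₁ ≠ p₂ := fun h => by omega
  have h13 : p₁ ≠ p₃ := fun h => by omega
  have h14 : p₁ ≠ p₄ := fun h => by omega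
  have hn6 := two_mul_3555_mod_eight h₁ h₂ h₃ h₄
  have hg : Odd (gK (2 * (p₁ * p₂ * p₃ * p₄))) := by
    rw [← ZMod.natCast_eq_one_iff_odd, natCast_gK_two_mul_3555 hp₁ hp₂ hp₃ hp₄ h₁ h₂ h₃ h₄ h23 h24 h34, hbits, add_zero]
  have hs := monskySelmerRankEven_3555 hp₁ hp₂ hp₃ hp₄ h₁ h₂ h₃ h₄ h23 h24 h34 hbits
  obtain ⟨-, x, hx0, hv, hx⟩ := rankOneDatum_two_mul_3555 hCM h11 hGZK hp₁ hp₂ hp₃ hp₄ h₁ h₂ h₃ h₄ h23 h24 h34 hg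
  obtain ⟨hr1, hrk, hsha, hiff⟩ :=
    rankOne_sha_bsdp_two_iff_congruentNumberCurve_two_mul_pqrs_descent hGZK hp₁ hp₂ hp₃ hp₄ h12 h13 h14 h23 h24 h34
      hn6 hs hx0 hx
  exact ⟨hr1, hrk, hsha, hiff.mpr hv⟩

end ThetaDescent

end Summit.BirchSwinnertonDyer.Rank1Residual.P2

end
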